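import Literature.Probability.Distributions.HermiteGaussian
import Literature.Algebra.Polynomial.FischerInnerProduct
import Mathlib.Probability.Distributions.Gaussian.Multivariate
import Mathlib.Analysis.InnerProductSpace.PiL2
import Mathlib.Analysis.Calculus.FDeriv.Mul
import Mathlib.Analysis.Calculus.Deriv.Comp
import Mathlib.MeasureTheory.Integral.Pi
import HarnessLib

/-!
# Product Hermite functions on a finite-dimensional Gaussian space (Wiener–Hermite dictionary)

Let `E` be a finite-dimensional real inner product space with its standard Gaussian measure
`γ = stdGaussian E`, and `b` an orthonormal basis indexed by `ι`. For a multi-index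
`α : ι →₀ ℕ` the *product Hermite function* is `H_α(v) = ∏ᵢ He_{αᵢ}(⟪bᵢ, v⟫)`
(`hermiteProd b α`), and a real polynomial `p = Σ p_α x^α` in the variables `ι` defines the
*Hermite evaluation* `𝓗_b p = Σ_α p_α H_α` (`hermiteEval b p`; this is the Wick-ordered
polynomial `:p(ξ):` of Janson 1997, Thm 3.21). We prove

* orthogonality `∫ H_α H_β dγ = α! δ_{αβ}` (`integral_hermiteProd_mul_hermiteProd`, Janson 1997
  Thm 3.21 (3.15) from the one-dimensional (3.12)), `∫ H_α dγ = δ_{α0}`;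
* the **isometry** `∫ (𝓗_b p)(𝓗_b q) dγ = ⟨p, q⟩_F` with the Fischer inner product
  (`integral_hermiteEval_mul_hermiteEval`), so `𝓗_b p = 0 ⇒ p = 0`;
* the **intertwining of derivatives**: `D_u H_α = Σⱼ ⟪bⱼ, u⟫ αⱼ H_{α-eⱼ}` and
  `fderiv (𝓗_b p) v u = 𝓗_b (Σⱼ ⟪bⱼ, u⟫ ∂ⱼ p) v` (`fderiv_hermiteEval_apply`): annihilation
  operators are directional derivatives (Janson 1997, Thm 13.8/Example 13.12 in spirit).

All statements are at function level (`E → ℝ`); integrability against `γ` of products of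
polynomial functions is recorded (`integrable_hermiteEval_mul`).

## References
* S. Janson, *Gaussian Hilbert Spaces*, Cambridge Tracts in Math. 129 (1997), Theorem 3.21
  (`:∏ ξᵢ^{αᵢ}: = ∏ h_{αᵢ}(ξᵢ)`, orthogonality and `E(:ξ^α:)² = α!`), Example 3.18 (3.12).
-/

open MeasureTheory ProbabilityTheory Polynomial Finset
open scoped InnerProductSpace Nat

namespace Literature.Probability.Distributions

open Literature.Algebra.Polynomial

noncomputable section

variable {E : Type*} [NormedAddCommGroup E] [InnerProductSpace ℝ E]
variable {ι : Type*} [Fintype ι] [DecidableEq ι]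

/-! ### Product Hermite functions and the Hermite evaluation of a polynomial -/

/-- The product Hermite function `H_α(v) = ∏ᵢ He_{αᵢ}(⟪bᵢ, v⟫)` attached to an orthonormal basis `b`
and a multi-index `α` (the Wick monomial `:ξ^α:`, Janson 1997 Thm 3.21 (3.15)). [cite: Janson1997, Thm 3.21] -/
def hermiteProd (b : OrthonormalBasis ι ℝ E) (α : ι →₀ ℕ) (v : E) : ℝ :=
  ∏ i, (hermiteR (α i)).eval ⟪b i, v⟫_ℝ

/-- The Hermite evaluation `𝓗_b p = Σ_α p_α H_α` of a real polynomial `p` in the variables `ι`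
(the Wick-ordered polynomial `:p(ξ):`). [cite: Janson1997, Thm 3.21] -/
def hermiteEval (b : OrthonormalBasis ι ℝ E) (p : MvPolynomial ι ℝ) (v : E) : ℝ :=
  ∑ α ∈ p.support, MvPolynomial.coeff α p * hermiteProd b α v

omit [DecidableEq ι] in
/-- `H_0 = 1`. [folklore] -/
@[simp]
theorem hermiteProd_zero (b : OrthonormalBasis ι ℝ E) (v : E) : hermiteProd b 0 v = 1 := by
  simp [hermiteProd]

omit [DecidableEq ι] in
/-- `H_α` is continuous. [folklore] -/
@[fun_prop]
theorem continuous_hermiteProd (b : OrthonormalBasis ι ℝ E) (α : ι →₀ ℕ) :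
    Continuous (hermiteProd b α) := by
  unfold hermiteProd
  fun_prop

omit [DecidableEq ι] in
/-- The defining sum of `𝓗_b p` may run over any finite set containing the support. [folklore] -/
theorem hermiteEval_eq_sum_of_subset (b : OrthonormalBasis ι ℝ E) {p : MvPolynomial ι ℝ}
    {s : Finset (ι →₀ ℕ)} (h : p.support ⊆ s) (v : E) :
    hermiteEval b p v = ∑ α ∈ s, MvPolynomial.coeff α p * hermiteProd b α v := by
  unfold hermiteEval
  refine Finset.sum_subset h fun α _ hα => ?_
  rw [MvPolynomial.notMem_support_iff.1 hα, zero_mul]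

/-- `𝓗_b` is additive. [folklore] -/
theorem hermiteEval_add (b : OrthonormalBasis ι ℝ E) (p q : MvPolynomial ι ℝ) (v : E) :
    hermiteEval b (p + q) v = hermiteEval b p v + hermiteEval b q v := by
  classical
  set s := p.support ∪ q.support ∪ (p + q).support with hs
  rw [hermiteEval_eq_sum_of_subset b (s := s), hermiteEval_eq_sum_of_subset b (s := s),
    hermiteEval_eq_sum_of_subset b (s := s), ← Finset.sum_add_distrib]
  · refine Finset.sum_congr rfl fun α _ => ?_
    rw [MvPolynomial.coeff_add, add_mul]
  all_goals intro x hx; simp only [hs, Finset.mem_union] at hx ⊢; tauto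

/-- `𝓗_b` is homogeneous. [folklore] -/
theorem hermiteEval_smul (b : OrthonormalBasis ι ℝ E) (c : ℝ) (p : MvPolynomial ι ℝ) (v : E) :
    hermiteEval b (c • p) v = c * hermiteEval b p v := by
  classical
  set s := p.support ∪ (c • p).support with hs
  rw [hermiteEval_eq_sum_of_subset b (s := s), hermiteEval_eq_sum_of_subset b (s := s),
    Finset.mul_sum]
  · refine Finset.sum_congr rfl fun α _ => ?_
    rw [MvPolynomial.coeff_smul, smul_eq_mul, mul_assoc]
  all_goals intro x hx; simp only [hs, Finset.mem_union] at hx ⊢; tauto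

omit [DecidableEq ι] in
/-- `𝓗_b 0 = 0`. [folklore] -/
@[simp]
theorem hermiteEval_zero (b : OrthonormalBasis ι ℝ E) (v : E) : hermiteEval b 0 v = 0 := by
  simp [hermiteEval]

/-- `𝓗_b (Σₖ fₖ) = Σₖ 𝓗_b fₖ`. [folklore] -/
theorem hermiteEval_sum {κ : Type*} (b : OrthonormalBasis ι ℝ E) (s : Finset κ)
    (f : κ → MvPolynomial ι ℝ) (v : E) :
    hermiteEval b (∑ k ∈ s, f k) v = ∑ k ∈ s, hermiteEval b (f k) v :=
  map_sum (AddMonoidHom.mk' (fun p => hermiteEval b p v) fun p q => hermiteEval_add b p q v) f s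

/-- `𝓗_b (a x^α) = a H_α`. [folklore] -/
theorem hermiteEval_monomial (b : OrthonormalBasis ι ℝ E) (α : ι →₀ ℕ) (a : ℝ) (v : E) :
    hermiteEval b (MvPolynomial.monomial α a) v = a * hermiteProd b α v := by
  rw [hermiteEval_eq_sum_of_subset b (s := {α}) (MvPolynomial.support_monomial_subset)]
  simp

omit [DecidableEq ι] in
/-- `𝓗_b p` as a function is the linear combination `Σ_α p_α H_α`. [folklore] -/
theorem hermiteEval_eq (b : OrthonormalBasis ι ℝ E) (p : MvPolynomial ι ℝ) :
    hermiteEval b p = fun v => ∑ α ∈ p.support, MvPolynomial.coeff α p * hermiteProd b α v := rfl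

omit [DecidableEq ι] in
/-- `𝓗_b p` is continuous. [folklore] -/
@[fun_prop]
theorem continuous_hermiteEval (b : OrthonormalBasis ι ℝ E) (p : MvPolynomial ι ℝ) :
    Continuous (hermiteEval b p) := by
  rw [hermiteEval_eq]
  fun_prop

/-! ### Orthogonality against the standard Gaussian -/

section Gaussian

variable [FiniteDimensional ℝ E] [MeasurableSpace E] [BorelSpace E]

omit [DecidableEq ι] [FiniteDimensional ℝ E] [MeasurableSpace E] [BorelSpace E] in
/-- In the coordinates of `b`, `H_α(Σ xⱼ bⱼ) = ∏ᵢ He_{αᵢ}(xᵢ)`. [folklore] -/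
theorem hermiteProd_basis_sum (b : OrthonormalBasis ι ℝ E) (α : ι →₀ ℕ) (x : ι → ℝ) :
    hermiteProd b α (∑ j, x j • b j) = ∏ i, (hermiteR (α i)).eval (x i) := by
  classical
  unfold hermiteProd
  refine Finset.prod_congr rfl fun i _ => ?_
  congr 1
  rw [inner_sum]
  simp_rw [inner_smul_right, orthonormal_iff_ite.1 b.orthonormal]
  simp

omit [DecidableEq ι] in
/-- Products of Hermite functions are integrable against the Maxwellian. [folklore] -/
theorem integrable_hermiteProd_mul_hermiteProd (b : OrthonormalBasis ι ℝ E) (α β : ι →₀ ℕ) :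
    Integrable (fun v => hermiteProd b α v * hermiteProd b β v) (stdGaussian E) := by
  classical
  rw [stdGaussian_eq_map_pi_orthonormalBasis b]
  refine (integrable_map_measure ((continuous_hermiteProd b α).mul
    (continuous_hermiteProd b β)).aestronglyMeasurable (Measurable.aemeasurable (by fun_prop))).2 ?_
  refine (Integrable.fintype_prod (f := fun i y => (hermiteR (α i)).eval y * (hermiteR (β i)).eval y)
    fun i => integrable_eval_mul_eval_gaussianReal _ _ 0 1).congr (ae_of_all _ fun x => ?_)
  simp only [Function.comp_apply, Pi.mul_apply, hermiteProd_basis_sum, Finset.prod_mul_distrib]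

omit [DecidableEq ι] in
/-- Hermite functions are integrable against the Maxwellian. [folklore] -/
theorem integrable_hermiteProd (b : OrthonormalBasis ι ℝ E) (α : ι →₀ ℕ) :
    Integrable (hermiteProd b α) (stdGaussian E) := by
  simpa using integrable_hermiteProd_mul_hermiteProd b α 0

/-- **Orthogonality of the product Hermite functions** (Janson 1997, Thm 3.21):
`∫ H_α H_β dγ = α! δ_{αβ}`. [cite: Janson1997, Thm 3.21] -/
theorem integral_hermiteProd_mul_hermiteProd (b : OrthonormalBasis ι ℝ E) (α β : ι →₀ ℕ) :
    ∫ v, hermiteProd b α v * hermiteProd b β v ∂stdGaussian E =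
      if α = β then mfactorial α else 0 := by
  classical
  rw [stdGaussian_eq_map_pi_orthonormalBasis b,
    integral_map (Measurable.aemeasurable (by fun_prop))
      (by fun_prop : Continuous fun v => hermiteProd b α v * hermiteProd b β v).aestronglyMeasurable]
  simp_rw [hermiteProd_basis_sum, ← Finset.prod_mul_distrib]
  rw [integral_fintype_prod_eq_prod
    (f := fun i y => (hermiteR (α i)).eval y * (hermiteR (β i)).eval y)]
  simp_rw [integral_hermiteR_mul_hermiteR]
  by_cases h : α = β
  · subst h
    simp [mfactorial]
  · rw [if_neg h]
    obtain ⟨i, hi⟩ : ∃ i, α i ≠ β i := by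
      by_contra hc
      push Not at hc
      exact h (Finsupp.ext hc)
    exact Finset.prod_eq_zero (Finset.mem_univ i) (if_neg hi)

/-- `∫ H_α dγ = δ_{α0}`. [cite: Janson1997, Thm 3.21] -/
theorem integral_hermiteProd (b : OrthonormalBasis ι ℝ E) (α : ι →₀ ℕ) :
    ∫ v, hermiteProd b α v ∂stdGaussian E = if α = 0 then 1 else 0 := by
  have h := integral_hermiteProd_mul_hermiteProd b α 0
  simp only [hermiteProd_zero, mul_one] at h
  rw [h]
  by_cases hα : α = 0
  · subst hα; simp [mfactorial]
  · rw [if_neg hα, if_neg hα]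

/-- `∫ H_α² dγ = α!`. [cite: Janson1997, Thm 3.21] -/
theorem integral_hermiteProd_sq (b : OrthonormalBasis ι ℝ E) (α : ι →₀ ℕ) :
    ∫ v, hermiteProd b α v ^ 2 ∂stdGaussian E = mfactorial α := by
  classical
  have h := integral_hermiteProd_mul_hermiteProd b α α
  rw [if_pos rfl] at h
  simpa [sq] using h

omit [DecidableEq ι] in
/-- Integrability of one term of the double sum `(𝓗_b p)(𝓗_b q)`. [folklore] -/
theorem integrable_coeff_mul_hermiteProd_mul (b : OrthonormalBasis ι ℝ E) (p q : MvPolynomial ι ℝ)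
    (α β : ι →₀ ℕ) :
    Integrable (fun v => MvPolynomial.coeff α p * hermiteProd b α v *
      (MvPolynomial.coeff β q * hermiteProd b β v)) (stdGaussian E) := by
  have : (fun v => MvPolynomial.coeff α p * hermiteProd b α v *
      (MvPolynomial.coeff β q * hermiteProd b β v)) = fun v =>
      (MvPolynomial.coeff α p * MvPolynomial.coeff β q) *
        (hermiteProd b α v * hermiteProd b β v) := by
    funext v; ring
  rw [this]
  exact (integrable_hermiteProd_mul_hermiteProd b α β).const_mul _

omit [DecidableEq ι] in
/-- Products of Hermite evaluations are integrable against the Maxwellian. [folklore] -/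
theorem integrable_hermiteEval_mul (b : OrthonormalBasis ι ℝ E) (p q : MvPolynomial ι ℝ) :
    Integrable (fun v => hermiteEval b p v * hermiteEval b q v) (stdGaussian E) := by
  simp only [hermiteEval, Finset.sum_mul, Finset.mul_sum]
  exact integrable_finsetSum _ fun α _ => integrable_finsetSum _ fun β _ =>
    integrable_coeff_mul_hermiteProd_mul b p q _ _

/-- Hermite evaluations are integrable against the Maxwellian. [folklore] -/
theorem integrable_hermiteEval (b : OrthonormalBasis ι ℝ E) (p : MvPolynomial ι ℝ) :
    Integrable (hermiteEval b p) (stdGaussian E) := by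
  have h := integrable_hermiteEval_mul b p 1
  have h1 : ∀ v, hermiteEval b (1 : MvPolynomial ι ℝ) v = 1 := fun v => by
    rw [show (1 : MvPolynomial ι ℝ) = MvPolynomial.monomial 0 1 from rfl, hermiteEval_monomial,
      one_mul, hermiteProd_zero]
  simpa [h1] using h

omit [DecidableEq ι] in
/-- Hermite evaluations are square integrable against the Maxwellian. [folklore] -/
theorem integrable_hermiteEval_sq (b : OrthonormalBasis ι ℝ E) (p : MvPolynomial ι ℝ) :
    Integrable (fun v => hermiteEval b p v ^ 2) (stdGaussian E) := by
  simpa [sq] using integrable_hermiteEval_mul b p p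

/-- **The Wiener–Hermite isometry**: `∫ (𝓗_b p)(𝓗_b q) dγ = ⟨p, q⟩_F`, the Fischer inner product
of the coefficient polynomials (Janson 1997, Thm 3.21: `{(α!)^{-1/2} :ξ^α:}` is orthonormal).
[cite: Janson1997, Thm 3.21] -/
theorem integral_hermiteEval_mul_hermiteEval (b : OrthonormalBasis ι ℝ E)
    (p q : MvPolynomial ι ℝ) :
    ∫ v, hermiteEval b p v * hermiteEval b q v ∂stdGaussian E = fischerInner p q := by
  classical
  set s := p.support ∪ q.support with hs
  have hp : ∀ v, hermiteEval b p v = ∑ α ∈ s, MvPolynomial.coeff α p * hermiteProd b α v :=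
    hermiteEval_eq_sum_of_subset b Finset.subset_union_left
  have hq : ∀ v, hermiteEval b q v = ∑ α ∈ s, MvPolynomial.coeff α q * hermiteProd b α v :=
    hermiteEval_eq_sum_of_subset b Finset.subset_union_right
  simp_rw [hp, hq, Finset.sum_mul, Finset.mul_sum]
  have hI := integrable_coeff_mul_hermiteProd_mul (E := E) b p q
  rw [integral_finsetSum _ fun α _ => integrable_finsetSum _ fun β _ => hI α β]
  have hinner : ∀ α, ∫ v, ∑ β ∈ s, MvPolynomial.coeff α p * hermiteProd b α v *
      (MvPolynomial.coeff β q * hermiteProd b β v) ∂stdGaussian E =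
      ∑ β ∈ s, MvPolynomial.coeff α p * MvPolynomial.coeff β q *
        (if α = β then mfactorial α else 0) := by
    intro α
    rw [integral_finsetSum _ fun β _ => hI α β]
    refine Finset.sum_congr rfl fun β _ => ?_
    rw [← integral_hermiteProd_mul_hermiteProd b α β, ← integral_const_mul]
    exact integral_congr_ae (ae_of_all _ fun v => by ring)
  simp_rw [hinner, mul_ite, mul_zero, Finset.sum_ite_eq]
  rw [fischerInner_eq_sum_of_subset (s := s) subset_rfl]
  refine Finset.sum_congr rfl fun α hα => ?_
  rw [if_pos hα]
  ring

/-- `‖𝓗_b p‖²_{L²(γ)} = ‖p‖²_F`. [cite: Janson1997, Thm 3.21] -/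
theorem integral_hermiteEval_sq (b : OrthonormalBasis ι ℝ E) (p : MvPolynomial ι ℝ) :
    ∫ v, hermiteEval b p v ^ 2 ∂stdGaussian E = fischerInner p p := by
  simpa [sq] using integral_hermiteEval_mul_hermiteEval b p p

/-- `⟨x^β, p⟩_F = β! p_β`. [folklore] -/
theorem fischerInner_monomial_one_left (β : ι →₀ ℕ) (p : MvPolynomial ι ℝ) :
    fischerInner (MvPolynomial.monomial β (1 : ℝ)) p = mfactorial β * MvPolynomial.coeff β p := by
  classical
  induction p using MvPolynomial.induction_on' with
  | monomial α a =>
    rw [fischerInner_monomial, MvPolynomial.coeff_monomial]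
    by_cases hβ : β = α
    · subst hβ; simp
    · rw [if_neg hβ, if_neg (Ne.symm hβ), mul_zero]
  | add p q hp hq =>
    rw [fischerInner_add_right, hp, hq, MvPolynomial.coeff_add, mul_add]

/-- `⟨𝓗_b p, H_β⟩_{L²(γ)} = β! p_β`: the Hermite coefficients are recovered by integration. [cite: Janson1997, Thm 3.21] -/
theorem integral_hermiteEval_mul_hermiteProd (b : OrthonormalBasis ι ℝ E) (p : MvPolynomial ι ℝ)
    (β : ι →₀ ℕ) :
    ∫ v, hermiteEval b p v * hermiteProd b β v ∂stdGaussian E =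
      mfactorial β * MvPolynomial.coeff β p := by
  have h : ∀ v, hermiteProd b β v = hermiteEval b (MvPolynomial.monomial β 1) v := fun v => by
    rw [hermiteEval_monomial, one_mul]
  simp_rw [h]
  rw [integral_hermiteEval_mul_hermiteEval, fischerInner_comm, fischerInner_monomial_one_left]

/-- **Injectivity of the Hermite evaluation**: a polynomial whose Wick evaluation vanishes
`γ`-almost everywhere (in particular, identically) is zero. [folklore] -/
theorem eq_zero_of_hermiteEval_ae_eq_zero (b : OrthonormalBasis ι ℝ E) {p : MvPolynomial ι ℝ}
    (h : hermiteEval b p =ᵐ[stdGaussian E] 0) : p = 0 := by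
  have h0 : fischerInner p p = 0 := by
    rw [← integral_hermiteEval_sq b p]
    refine integral_eq_zero_of_ae ?_
    filter_upwards [h] with v hv
    simp [hv]
  rw [fischerInner_self_eq] at h0
  ext α
  rw [MvPolynomial.coeff_zero]
  by_contra hα
  have hmem : α ∈ p.support := MvPolynomial.mem_support_iff.2 hα
  have hpos : 0 < ∑ α ∈ p.support, mfactorial α * MvPolynomial.coeff α p ^ 2 :=
    Finset.sum_pos' (fun α _ => mul_nonneg (mfactorial_pos α).le (sq_nonneg _))
      ⟨α, hmem, mul_pos (mfactorial_pos α) (by positivity)⟩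
  linarith

/-- A polynomial whose Wick evaluation vanishes identically is zero. [folklore] -/
theorem eq_zero_of_hermiteEval_eq_zero (b : OrthonormalBasis ι ℝ E) {p : MvPolynomial ι ℝ}
    (h : hermiteEval b p = 0) : p = 0 :=
  eq_zero_of_hermiteEval_ae_eq_zero b (ae_of_all _ fun v => by rw [h])

end Gaussian

/-! ### Directional derivatives: annihilation operators -/

section Deriv

omit [DecidableEq ι] in
/-- The derivative of `v ↦ Heₙ(⟪bᵢ, v⟫)`: `Heₙ'(⟪bᵢ, v⟫) ⟪bᵢ, ·⟫`. [folklore] -/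
theorem hasFDerivAt_eval_hermiteR_inner (b : OrthonormalBasis ι ℝ E) (n : ℕ) (i : ι) (v : E) :
    HasFDerivAt (fun w : E => (hermiteR n).eval ⟪b i, w⟫_ℝ)
      (((derivative (hermiteR n)).eval ⟪b i, v⟫_ℝ) • innerSL ℝ (b i)) v := by
  have h1 : HasFDerivAt (fun w : E => ⟪b i, w⟫_ℝ) (innerSL ℝ (b i)) v :=
    (innerSL ℝ (b i)).hasFDerivAt
  have h2 := (hermiteR n).hasDerivAt ⟪b i, v⟫_ℝ
  exact h2.comp_hasFDerivAt v h1

/-- `Heₙ' = n He_{n-1}` as real polynomials (with `He₋₁ := 0` irrelevant since `n = 0` gives `0`). [folklore] -/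
theorem derivative_hermiteR (n : ℕ) :
    derivative (hermiteR n) = Polynomial.C (n : ℝ) * hermiteR (n - 1) := by
  cases n with
  | zero => simp
  | succ n =>
    rw [derivative_hermiteR_succ, Nat.add_sub_cancel, Nat.cast_succ]

/-- **Directional derivative of a product Hermite function**:
`D_u H_α (v) = Σⱼ ⟪bⱼ, u⟫ αⱼ H_{α - eⱼ}(v)`. [cite: Janson1997, Thm 3.21] -/
theorem hasFDerivAt_hermiteProd (b : OrthonormalBasis ι ℝ E) (α : ι →₀ ℕ) (v : E) :
    HasFDerivAt (hermiteProd b α)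
      (∑ j, ((α j : ℝ) * hermiteProd b (α - Finsupp.single j 1) v) • innerSL ℝ (b j)) v := by
  classical
  have h := HasFDerivAt.finsetProd (u := Finset.univ)
    (g := fun i (w : E) => (hermiteR (α i)).eval ⟪b i, w⟫_ℝ)
    (fun i _ => hasFDerivAt_eval_hermiteR_inner b (α i) i v)
  have hfun : (fun w : E => ∏ i ∈ Finset.univ, (hermiteR (α i)).eval ⟪b i, w⟫_ℝ) =
      hermiteProd b α := by
    funext w; rfl
  have hderiv : (∑ i ∈ Finset.univ, (∏ j ∈ Finset.univ.erase i, (hermiteR (α j)).eval ⟪b j, v⟫_ℝ) •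
      (((derivative (hermiteR (α i))).eval ⟪b i, v⟫_ℝ) • innerSL ℝ (b i))) =
      ∑ j, ((α j : ℝ) * hermiteProd b (α - Finsupp.single j 1) v) • innerSL ℝ (b j) := by
    refine Finset.sum_congr rfl fun j _ => ?_
    rw [smul_smul]
    congr 1
    -- `(∏_{k ≠ j} He_{α k}(x_k)) · He'_{α j}(x_j) = α_j H_{α - e_j}`
    rw [derivative_hermiteR, eval_mul, eval_C, hermiteProd,
      ← Finset.mul_prod_erase Finset.univ _ (Finset.mem_univ j)]
    have hne : ∀ k ∈ Finset.univ.erase j,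
        (hermiteR ((α - Finsupp.single j 1 : ι →₀ ℕ) k)).eval ⟪b k, v⟫_ℝ =
          (hermiteR (α k)).eval ⟪b k, v⟫_ℝ := by
      intro k hk
      simp [(Finset.ne_of_mem_erase hk).symm]
    rw [Finset.prod_congr rfl hne]
    simp only [Finsupp.tsub_apply, Finsupp.single_eq_same]
    ring
  rw [hfun, hderiv] at h
  exact h

/-- The derivative of `𝓗_b p` in the direction `u`:
`fderiv (𝓗_b p) v u = 𝓗_b (Σⱼ ⟪bⱼ, u⟫ ∂ⱼ p) v` (annihilation along `u`). [cite: Janson1997, Thm 3.21] -/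
theorem hasFDerivAt_hermiteEval (b : OrthonormalBasis ι ℝ E) (p : MvPolynomial ι ℝ) (v : E) :
    HasFDerivAt (hermiteEval b p)
      (∑ α ∈ p.support, MvPolynomial.coeff α p •
        ∑ j, ((α j : ℝ) * hermiteProd b (α - Finsupp.single j 1) v) • innerSL ℝ (b j)) v := by
  rw [hermiteEval_eq]
  exact HasFDerivAt.fun_sum fun α _ => (hasFDerivAt_hermiteProd b α v).const_mul _

/-- `𝓗_b (∂ⱼ p) = Σ_α p_α αⱼ H_{α - eⱼ}`. [folklore] -/
theorem hermiteEval_pderiv (b : OrthonormalBasis ι ℝ E) (j : ι) (p : MvPolynomial ι ℝ) (v : E) :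
    hermiteEval b (MvPolynomial.pderiv j p) v =
      ∑ α ∈ p.support, MvPolynomial.coeff α p * ((α j : ℝ) * hermiteProd b (α - Finsupp.single j 1) v) := by
  classical
  induction p using MvPolynomial.induction_on' with
  | monomial α a =>
    rw [MvPolynomial.pderiv_monomial, hermiteEval_monomial]
    by_cases ha : a = 0
    · subst ha; simp
    · rw [MvPolynomial.support_monomial, if_neg ha, Finset.sum_singleton,
        MvPolynomial.coeff_monomial, if_pos rfl]
      ring
  | add p q hp hq =>
    rw [map_add, hermiteEval_add, hp, hq]
    set s := p.support ∪ q.support ∪ (p + q).support with hs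
    have hsub : ∀ {r : MvPolynomial ι ℝ}, r.support ⊆ s →
        ∑ α ∈ r.support, MvPolynomial.coeff α r *
          ((α j : ℝ) * hermiteProd b (α - Finsupp.single j 1) v) =
        ∑ α ∈ s, MvPolynomial.coeff α r *
          ((α j : ℝ) * hermiteProd b (α - Finsupp.single j 1) v) := fun hr =>
      Finset.sum_subset hr fun α _ hα => by
        rw [MvPolynomial.notMem_support_iff.1 hα, zero_mul]
    rw [hsub (r := p), hsub (r := q), hsub (r := p + q), ← Finset.sum_add_distrib]
    · refine Finset.sum_congr rfl fun α _ => ?_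
      rw [MvPolynomial.coeff_add]
      ring
    all_goals intro x hx; simp only [hs, Finset.mem_union] at hx ⊢; tauto

/-- **Directional derivatives of Wick polynomials are Wick polynomials**:
`fderiv (𝓗_b p) v u = 𝓗_b (Σⱼ ⟪bⱼ, u⟫ • ∂ⱼ p) v`. [cite: Janson1997, Thm 3.21] -/
theorem fderiv_hermiteEval_apply (b : OrthonormalBasis ι ℝ E) (p : MvPolynomial ι ℝ) (v u : E) :
    fderiv ℝ (hermiteEval b p) v u =
      hermiteEval b (∑ j, ⟪b j, u⟫_ℝ • MvPolynomial.pderiv j p) v := by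
  rw [(hasFDerivAt_hermiteEval b p v).fderiv, hermiteEval_sum]
  simp only [_root_.sum_apply, smul_apply, innerSL_apply_apply, smul_eq_mul, hermiteEval_smul,
    hermiteEval_pderiv, Finset.mul_sum]
  rw [Finset.sum_comm]
  refine Finset.sum_congr rfl fun j _ => Finset.sum_congr rfl fun α _ => ?_
  ring

/-- `𝓗_b p` is differentiable. [folklore] -/
theorem differentiable_hermiteEval (b : OrthonormalBasis ι ℝ E) (p : MvPolynomial ι ℝ) :
    Differentiable ℝ (hermiteEval b p) := fun v =>
  (hasFDerivAt_hermiteEval b p v).differentiableAt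

end Deriv

end

end Literature.Probability.Distributions
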